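import Mathlib
import Literature.NumberTheory.LFunctions.Zhang2022.Section6Statements
import HarnessLib

/-!
# Zhang (2022), §6: the Perron step of the proof of Lemma 6.1 (`Z22:§6.u007`), discharged

Topic `Literature/NumberTheory/LFunctions/Zhang2022` (Landau–Siegel audit tree; verdict-neutral).
Y. Zhang, *Discrete mean estimates and the Landau–Siegel zero*, arXiv:2211.02515v1 (2022)
[Zhang2022LandauSiegel] — an unrefereed manuscript under adjudication; nothing here asserts or
denies its Theorems 1–2. Campaign D-0069, discharge of a typed §6 proof-step (file
`Section6Statements`, node `Step6u007`):

> §6 p. 31 (tex L1707): "By (4.3) we have `(1/2πi)∫_{(1)} L(s+w,ψ)P₄^w ω₁(w)dw/w = K(s,ψ) + O(ε)`."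

PROVED here as `step6u007_holds : Section6Statements.Step6u007`, with `ε = exp{−𝓛¹⁰}` (`c = 1`),
implied constant `1`, for all `D ≥ 8`, every `ψ ∈ Ψ` and every `s` in the range of Lemma 6.1
(the (A) antecedent is not used). The printed argument, formalised: on `Re w = 1` the series
`L(s+w,ψ) = Σ ψ(n)n^{−s−w}` converges absolutely (Mathlib `DirichletCharacter.LFunction_eq_LSeries`),
so the Gaussian Perron formula of §4 (the tree's `GaussWeight.integral_LSeries_mul_kernel`, i.e. the
(4.1) mechanism) evaluates the line integral as `Σₙ ψ(n)n^{−s}g(P₄/n)`; the terms `n < 2P₄` are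
exactly `K(s,ψ)` (`g*(P₄/n) = g(P₄/n)` there), and the tail `n ≥ 2P₄` is bounded termwise by (4.3)
(`GaussWeight.gWeight_le`): `n^{−σ}·½e^{−𝓛³⁰log²(n/P₄)} ≤ ½e^{−𝓛³⁰log²2 + 2(log 2 + 𝓛⁹ + 519𝓛)}·n⁻²`
(`log²(n/P₄) ≥ log 2·log(n/P₄)`, `𝓛³⁰log 2 ≥ 2`, `log P₄ ≤ 𝓛⁹ + 519𝓛`), summed with
`Σ n⁻² = π²/6 ≤ 2`, and finally `−𝓛³⁰log²2 + 2(log 2 + 𝓛⁹ + 519𝓛) ≤ −𝓛¹⁰` for `𝓛 ≥ 2`.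
No new facts; axioms standard.

## References

* Y. Zhang, arXiv:2211.02515v1 (2022), §6 p. 31 (tex L1707); §4 (4.1), (4.3) p. 18.
  [cite: Zhang2022LandauSiegel, §6 p.31; §4 (4.1), (4.3)]
-/

noncomputable section

open Complex Real ComplexConjugate MeasureTheory

namespace Literature.NumberTheory.LFunctions.Zhang2022.Section6Statements

open Skeleton

/-! ### Auxiliary real-analysis facts -/

/-- `2 ≤ log D` for `D ≥ 8`. [folklore] -/
private theorem two_le_ell {D : ℕ} (hD : 8 ≤ D) : 2 ≤ ell D := by
  have hD' : (8 : ℝ) ≤ D := by exact_mod_cast hD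
  have h8 : Real.exp 2 ≤ 8 := by
    have h1 := Real.exp_one_lt_d9
    have : Real.exp 2 = Real.exp 1 * Real.exp 1 := by rw [← Real.exp_add]; norm_num
    rw [this]; nlinarith [Real.exp_pos 1]
  rw [ell]
  exact (Real.le_log_iff_exp_le (by linarith)).mpr (le_trans h8 hD')

/-- The per-term exponent inequality behind the tail bound: for `L ≥ ℓ₂ + p` (i.e. `n ≥ 2P₄`),
`Λℓ₂ ≥ 2`, `ℓ₂ ≥ 0`: `−σL − Λ(L − p)² ≤ −Λℓ₂² + (2 − σ)(ℓ₂ + p) − 2L`. [folklore] -/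
private theorem exponent_bound {σ L p Λ ℓ₂ : ℝ} (hσ : 0 ≤ σ) (hℓ : 0 ≤ ℓ₂) (hΛ : 2 ≤ Λ * ℓ₂)
    (hΛ0 : 0 ≤ Λ) (hL : ℓ₂ + p ≤ L) :
    -σ * L - Λ * (L - p) ^ 2 ≤ -Λ * ℓ₂ ^ 2 + (2 - σ) * (ℓ₂ + p) - 2 * L := by
  -- (L − p)² ≥ ℓ₂ (L − p) since L − p ≥ ℓ₂ ≥ 0
  have h1 : ℓ₂ * (L - p) ≤ (L - p) ^ 2 := by nlinarith
  have h2 : -Λ * (L - p) ^ 2 ≤ -Λ * (ℓ₂ * (L - p)) := by nlinarith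
  -- −σL − Λℓ₂(L − p) − RHS = (2 − σ − Λℓ₂)(L − p − ℓ₂) ≤ 0
  have key : (-σ * L - Λ * (ℓ₂ * (L - p))) - (-Λ * ℓ₂ ^ 2 + (2 - σ) * (ℓ₂ + p) - 2 * L)
      = (2 - σ - Λ * ℓ₂) * (L - p - ℓ₂) := by ring
  have h3 : (2 - σ - Λ * ℓ₂) * (L - p - ℓ₂) ≤ 0 :=
    mul_nonpos_of_nonpos_of_nonneg (by linarith) (by linarith)
  linarith

/-- `log P₄ ≤ 𝓛⁹ + 519𝓛` (`P₄ = PT⁻²t₀`, `T ≥ 1`, `log t₀ = 519 log 𝓛 ≤ 519𝓛`), for `𝓛 ≥ 2`.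
[cite: Zhang2022LandauSiegel, §6 p.30, tex L1688] -/
private theorem log_P4_le {D : ℕ} (hℓ : 2 ≤ ell D) : Real.log (P4 D) ≤ ell D ^ 9 + 519 * ell D := by
  have hℓ0 : 0 < ell D := by linarith
  have hP : 0 < bigP D := Real.exp_pos _
  have hT : 0 < bigT D := Real.exp_pos _
  have ht : 0 < t0 D := pow_pos hℓ0 519
  rw [P4, Real.log_mul (div_pos hP (by positivity)).ne' ht.ne', Real.log_div hP.ne' (by positivity),
    bigP, Real.log_exp, t0, Real.log_pow, Real.log_pow]
  have h1 : 0 ≤ Real.log (bigT D) :=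
    Real.log_nonneg (by rw [bigT]; exact Real.one_le_exp (by positivity))
  have h2 : Real.log (ell D) ≤ ell D := (Real.log_le_sub_one_of_pos hℓ0).trans (by linarith)
  push_cast
  linarith

/-- The final size comparison: `2ℓ₂ + 2(𝓛⁹ + 519𝓛)·… ` — precisely
`-(𝓛³⁰) ℓ₂² + 2(ℓ₂ + 𝓛⁹ + 519𝓛) ≤ −𝓛¹⁰` for `𝓛 ≥ 2`, `ℓ₂ = log 2`. [folklore] -/
private theorem size_bound {ℓ : ℝ} (hℓ : 2 ≤ ℓ) :
    -(ℓ ^ 30) * Real.log 2 ^ 2 + 2 * (Real.log 2 + ℓ ^ 9 + 519 * ℓ) ≤ -(ℓ ^ 10) := by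
  have hl2 : 0.6931471803 < Real.log 2 := Real.log_two_gt_d9
  have hl2' : Real.log 2 < 0.6931471808 := Real.log_two_lt_d9
  have hsq : 0.48 ≤ Real.log 2 ^ 2 := by nlinarith
  set A := ℓ ^ 10 with hA
  have hA1 : 1024 ≤ A := by
    have : (2 : ℝ) ^ 10 ≤ ℓ ^ 10 := pow_le_pow_left₀ (by norm_num) hℓ 10
    norm_num at this; linarith
  have h30 : ℓ ^ 30 = A * A * A := by rw [hA]; ring
  have h9 : ℓ ^ 9 ≤ A := by
    have : ℓ ^ 9 * 1 ≤ ℓ ^ 9 * ℓ := mul_le_mul_of_nonneg_left (by linarith) (by positivity)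
    calc ℓ ^ 9 = ℓ ^ 9 * 1 := by ring
      _ ≤ ℓ ^ 9 * ℓ := this
      _ = A := by rw [hA]; ring
  have h1 : ℓ ≤ A := by
    calc ℓ = ℓ ^ 1 := (pow_one ℓ).symm
      _ ≤ ℓ ^ 10 := pow_le_pow_right₀ (by linarith) (by norm_num)
      _ = A := by rw [hA]
  rw [h30]
  have hAA : 1024 * 1024 * A ≤ A * A * A := by nlinarith
  nlinarith

/-! ### The discharge -/

/-- **`Z22:§6.u007` DISCHARGED.** "By (4.3) we have `(1/2πi)∫_{(1)} L(s+w,ψ)P₄^w ω₁(w)dw/w =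
K(s,ψ) + O(ε)`": with `ε = exp{−𝓛¹⁰}` (`c = 1`) and implied constant `1`, for `D ≥ 8`. Proof as in
the source: on `Re w = 1`, `L(s+w,ψ) = Σ ψ(n)n^{−s−w}` converges absolutely, so the Gaussian Perron
formula (tree `GaussWeight.integral_LSeries_mul_kernel`, the (4.1) mechanism) gives
`Σₙ ψ(n)n^{−s}g(P₄/n)`; the terms `n < 2P₄` are `K(s,ψ)` (`g* = g` there) and the tail `n ≥ 2P₄` is
bounded termwise by (4.3) (`gWeight_le`): `n^{−σ}·½e^{−𝓛³⁰log²(n/P₄)} ≤ ½e^{−𝓛³⁰log²2}(2P₄)^{2−σ}n⁻²`,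
summed with `Σ n⁻² = π²/6`, and `e^{−𝓛³⁰log²2}(2P₄)² ≤ e^{−𝓛¹⁰}`.
[cite: Zhang2022LandauSiegel, §6 p.31, tex L1707] -/
theorem step6u007_holds : Step6u007 := by
  refine ⟨1, one_pos, 1, 8, fun D _ χ hD _ _ _ x s hr => ?_⟩
  -- parameters
  have hℓ : 2 ≤ ell D := two_le_ell hD
  have hℓ0 : 0 < ell D := by linarith
  set Λ : ℝ := ell D ^ 30 with hΛdef
  have hΛ : 0 < Λ := by positivity
  set P : ℝ := P4 D with hPdef
  have hP : 0 < P := by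
    rw [hPdef, P4]; exact mul_pos (div_pos (Real.exp_pos _) (pow_pos (Real.exp_pos _) _))
      (pow_pos hℓ0 519)
  -- the range: 1/4 < σ < 3/4
  have hα : alpha D < 1 / 8 := by
    rw [alpha, bigP, Real.log_exp]
    have h9 : (2 : ℝ) ^ 9 ≤ ell D ^ 9 := pow_le_pow_left₀ (by norm_num) hℓ 9
    rw [div_lt_iff₀ (by positivity)]
    nlinarith [Real.pi_lt_four]
  obtain ⟨hσ, -⟩ := hr
  have hσ1 : 1 / 4 < s.re := by
    have := (abs_lt.mp hσ).1; linarith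
  have hσ2 : s.re < 3 / 4 := by
    have := (abs_lt.mp hσ).2; linarith
  set σ : ℝ := s.re with hσdef
  -- Step 1: the Perron formula
  set a : ℕ → ℂ := psiFn x with hadef
  have hLS : LSeriesSummable a (s + ((1 : ℝ) : ℂ)) := by
    have := DirichletCharacter.LSeriesSummable_of_one_lt_re x.ψ
      (s := s + ((1 : ℝ) : ℂ)) (by simp; linarith)
    exact this
  have hperron : vline (integrandL x s) 1 =
      ∑' n : ℕ, LSeries.term a s n * (GaussWeight.gWeight Λ (P / n) : ℂ) := by
    rw [← GaussWeight.integral_LSeries_mul_kernel hΛ one_pos hP hLS, vline]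
    congr 1
    refine integral_congr_ae (Filter.Eventually.of_forall fun v => ?_)
    simp only [integrandL]
    rw [DirichletCharacter.LFunction_eq_LSeries x.ψ (by simp; linarith)]
    rfl
  -- Step 2: split off the terms `n < 2P₄`, which give `K(s,ψ)`
  set N : ℕ := ⌈2 * P⌉₊ with hNdef
  set F : ℕ → ℂ := fun n => LSeries.term a s n * (GaussWeight.gWeight Λ (P / n) : ℂ) with hFdef
  set G : ℕ → ℂ := fun n => if n ∈ Finset.Ico 1 N then 0 else F n with hGdef
  set Fin : ℕ → ℂ := fun n => if n ∈ Finset.Ico 1 N then F n else 0 with hFindef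
  have hsplit : ∀ n, F n = Fin n + G n := by
    intro n; simp only [hGdef, hFindef]; split_ifs <;> simp
  have hFin_supp : ∀ n ∉ Finset.Ico 1 N, Fin n = 0 := by
    intro n hn; simp only [hFindef, if_neg hn]
  have hFin_sum : Summable Fin := summable_of_ne_finset_zero hFin_supp
  have hK : ∑' n, Fin n = Kchar D (psiFn x) s := by
    rw [tsum_eq_sum hFin_supp, Kchar]
    refine Finset.sum_congr rfl fun n hn => ?_
    have hn' := hn
    rw [Finset.mem_Ico] at hn'
    have hn0 : n ≠ 0 := by omega
    have hnP : (n : ℝ) < 2 * P := by rw [hPdef]; exact Nat.lt_ceil.mp hn'.2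
    have hnpos : (0 : ℝ) < n := by exact_mod_cast Nat.pos_of_ne_zero hn0
    have hn2 : n ∈ Finset.Ico 1 N := by rw [hNdef, hPdef]; exact hn
    have hg : gstar D (P4 D / n) = GaussWeight.gWeight Λ (P / n) := by
      rw [gstar, if_pos, gW]
      rw [← hPdef, lt_div_iff₀ hnpos]; linarith
    simp only [hFindef, if_pos hn2, hFdef, LSeries.term_of_ne_zero hn0, hg, hadef, psiFn]
    rw [div_eq_mul_inv, ← cpow_neg]
  -- Step 3: the tail bound, termwise
  set ℓ₂ : ℝ := Real.log 2 with hℓ₂def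
  have hℓ₂0 : 0 < ℓ₂ := Real.log_pos (by norm_num)
  have hΛℓ : 2 ≤ Λ * ℓ₂ := by
    have hl2 : 0.6931471803 < Real.log 2 := Real.log_two_gt_d9
    have h30 : (2 : ℝ) ^ 30 ≤ ell D ^ 30 := pow_le_pow_left₀ (by norm_num) hℓ 30
    rw [hΛdef, hℓ₂def]; nlinarith
  set M : ℝ := 2 * (ℓ₂ + ell D ^ 9 + 519 * ell D) with hMdef
  have hM0 : 0 ≤ M := by rw [hMdef]; positivity
  have hlog2P : Real.log (2 * P) = ℓ₂ + Real.log P := Real.log_mul (by norm_num) hP.ne'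
  have hlogP : Real.log P ≤ ell D ^ 9 + 519 * ell D := log_P4_le hℓ
  set c₀ : ℝ := (1 / 2) * Real.exp (-Λ * ℓ₂ ^ 2 + M) with hc₀def
  have hc₀ : 0 ≤ c₀ := by positivity
  have hbound : ∀ n, ‖G n‖ ≤ c₀ * (1 / (n : ℝ) ^ 2) := by
    intro n
    by_cases hn : n ∈ Finset.Ico 1 N
    · simp only [hGdef, if_pos hn, norm_zero]; positivity
    rcases eq_or_ne n 0 with rfl | hn0
    · simp [hGdef, hFdef, LSeries.term_zero]
    -- n ≥ N, i.e. n ≥ 2P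
    have hnN : N ≤ n := by
      rw [Finset.mem_Ico, not_and_or] at hn
      rcases hn with h | h <;> omega
    have hnP : 2 * P ≤ n := le_trans (Nat.le_ceil _) (by exact_mod_cast hnN)
    have hnpos : (0 : ℝ) < n := by exact_mod_cast Nat.pos_of_ne_zero hn0
    set L : ℝ := Real.log n with hLdef
    have hL : ℓ₂ + Real.log P ≤ L := by
      rw [← hlog2P, hLdef]; exact Real.log_le_log (by positivity) hnP
    -- ‖F n‖ = ‖ψ n‖ n^{-σ} g(P/n) ≤ e^{-σL} · ½ e^{-Λ (log(P/n))²}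
    have hg0 : 0 < GaussWeight.gWeight Λ (P / n) := GaussWeight.gWeight_pos hΛ _
    have hg1 : GaussWeight.gWeight Λ (P / n) ≤ 1 / 2 * Real.exp (-Λ * Real.log (P / n) ^ 2) :=
      GaussWeight.gWeight_le hΛ (div_pos hP hnpos)
        (by rw [div_le_one hnpos]; linarith)
    have hlogPn : Real.log (P / n) = Real.log P - L := by rw [Real.log_div hP.ne' hnpos.ne', hLdef]
    have ha1 : ‖a n‖ ≤ 1 := by
      rw [hadef]; exact DirichletCharacter.norm_le_one x.ψ _
    have hnorm : ‖G n‖ = ‖a n‖ / (n : ℝ) ^ σ * GaussWeight.gWeight Λ (P / n) := by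
      simp only [hGdef, if_neg hn, hFdef, norm_mul, LSeries.norm_term_eq, if_neg hn0,
        Complex.norm_real, Real.norm_eq_abs, abs_of_pos hg0, hσdef]
    have hrpow : (n : ℝ) ^ σ = Real.exp (σ * L) := by
      rw [Real.rpow_def_of_pos hnpos, hLdef, mul_comm]
    have hexp := exponent_bound (by linarith : 0 ≤ σ) hℓ₂0.le hΛℓ hΛ.le hL
    have hstep : ‖G n‖ ≤ Real.exp (-σ * L) * (1 / 2 * Real.exp (-Λ * (L - Real.log P) ^ 2)) := by
      rw [hnorm, hrpow]
      have : ‖a n‖ / Real.exp (σ * L) ≤ Real.exp (-σ * L) := by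
        rw [div_le_iff₀ (Real.exp_pos _), ← Real.exp_add]; simp; exact ha1
      calc ‖a n‖ / Real.exp (σ * L) * GaussWeight.gWeight Λ (P / n)
          ≤ Real.exp (-σ * L) * GaussWeight.gWeight Λ (P / n) :=
            mul_le_mul_of_nonneg_right this hg0.le
        _ ≤ Real.exp (-σ * L) * (1 / 2 * Real.exp (-Λ * Real.log (P / n) ^ 2)) :=
            mul_le_mul_of_nonneg_left hg1 (Real.exp_pos _).le
        _ = Real.exp (-σ * L) * (1 / 2 * Real.exp (-Λ * (L - Real.log P) ^ 2)) := by
            rw [hlogPn]; ring_nf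
    -- combine exponents
    have hcomb : Real.exp (-σ * L) * (1 / 2 * Real.exp (-Λ * (L - Real.log P) ^ 2))
        = 1 / 2 * Real.exp (-σ * L - Λ * (L - Real.log P) ^ 2) := by
      have : Real.exp (-σ * L) * Real.exp (-Λ * (L - Real.log P) ^ 2)
          = Real.exp (-σ * L - Λ * (L - Real.log P) ^ 2) := by
        rw [← Real.exp_add]; congr 1; ring
      rw [← this]; ring
    have hσM : (2 - σ) * (ℓ₂ + Real.log P) ≤ M := by
      by_cases h : 0 ≤ ℓ₂ + Real.log P
      · calc (2 - σ) * (ℓ₂ + Real.log P) ≤ 2 * (ℓ₂ + Real.log P) :=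
            mul_le_mul_of_nonneg_right (by linarith) h
          _ ≤ M := by rw [hMdef]; nlinarith
      · push Not at h
        have : (2 - σ) * (ℓ₂ + Real.log P) ≤ 0 :=
          mul_nonpos_of_nonneg_of_nonpos (by linarith) h.le
        linarith
    have hn2 : Real.exp (-2 * L) = 1 / (n : ℝ) ^ 2 := by
      rw [hLdef, show (-2 : ℝ) * Real.log n = -(Real.log n + Real.log n) by ring, Real.exp_neg,
        Real.exp_add, Real.exp_log hnpos, one_div, sq]
    calc ‖G n‖ ≤ 1 / 2 * Real.exp (-σ * L - Λ * (L - Real.log P) ^ 2) := by rw [← hcomb]; exact hstep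
      _ ≤ 1 / 2 * Real.exp (-Λ * ℓ₂ ^ 2 + M + -2 * L) := by
          gcongr
          linarith
      _ = c₀ * (1 / (n : ℝ) ^ 2) := by rw [Real.exp_add, hn2, hc₀def]; ring
  have hG_sum : Summable G :=
    Summable.of_norm_bounded (hasSum_zeta_two.mul_left c₀).summable hbound
  -- Step 4: assemble
  have hS : vline (integrandL x s) 1 = Kchar D (psiFn x) s + ∑' n, G n := by
    rw [hperron, ← hK, ← hFin_sum.tsum_add hG_sum]
    exact tsum_congr hsplit
  rw [hS, add_sub_cancel_left]
  have htail : ‖∑' n, G n‖ ≤ c₀ * (π ^ 2 / 6) :=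
    tsum_of_norm_bounded (hasSum_zeta_two.mul_left c₀) hbound
  have hπ : π ^ 2 / 6 ≤ 2 := by nlinarith [Real.pi_lt_d2, Real.pi_pos]
  have hsize := size_bound hℓ
  calc ‖∑' n, G n‖ ≤ c₀ * (π ^ 2 / 6) := htail
    _ ≤ c₀ * 2 := mul_le_mul_of_nonneg_left hπ hc₀
    _ = Real.exp (-Λ * ℓ₂ ^ 2 + M) := by rw [hc₀def]; ring
    _ ≤ Real.exp (-(ell D ^ 10)) := by
        rw [Real.exp_le_exp, hΛdef, hMdef, hℓ₂def]; linarith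
    _ = 1 * Real.exp (-1 * ell D ^ 10) := by ring_nf

end Literature.NumberTheory.LFunctions.Zhang2022.Section6Statements
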